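import Literature.NumberTheory.Sieve.RosserSieveTheoremOneHalfLt
import Literature.NumberTheory.Sieve.PolynomialValuesSieveBounds
import HarnessLib

/-!
# Sieve inputs of dimension `2` for polynomial sequences (Iwaniec's `β`-sieve, `κ = 2`)

Topic `Literature/NumberTheory/Sieve`. The tree PROVES Iwaniec's Rosser-sieve theorem (Acta Arith.
36 (1980), Thm 1) for every dimension `κ > 1/2` (`RosserSieveTheoremOneHalfLt.lean`). This file
specialises it to `κ = 2` with Iwaniec's CANONICAL data
(`iwaniecUpperSieveFun 2 = F₂`, `iwaniecLowerSieveFun 2 = f₂`; both bounds for the SAME data, as the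
weighted sieve compares them) and to the polynomial sequences `polyAPSeq f N q r` of
`PolynomialValuesSieveSequence.lean` (values `f(n)`, `1 ≤ n ≤ N`, `n ≡ r (mod q)`; density
`ω_f(m)/m`, remainder `|R_m| ≤ ω_f(m)`), for `f ∈ ℤ[X]` with `ω_f(2) ≤ 1`, `ω_f(p) ≤ 2` and a
density of Iwaniec dimension `Ω(2, L)`. These are the two sieve estimates consumed by the weighted
sieve of Diamond–Halberstam 1997, Thm 1 (= Halberstam–Richert Thm 10.1) in the proof of
`DiamondHalberstam1997_twoLinear_P5` (Table 1, `g = 2`). Everything is PROVED: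

* `Iwaniec1980_two_lower`, `Iwaniec1980_two_upper` — Theorem 1 in `y`-form at `κ = 2` for the
  canonical data (uniform constant `C = C(L)`).
* `sum_remainder_range_le` — the remainder sum of Theorem 1 for `polyAPSeq f N q r` is
  `≤ y e⁸ log² z` when no prime `< z` divides `q` (`sum_rootCount_divisors_le`).
* `card_coprime_ge` — lower bound: `#{1 ≤ n ≤ N : (f(n), P(z)) = 1} ≥ N V(z) (f₂(log D/log z) −
  C (log D)^{−1/3}) − D e⁸ log² z` (`2 ≤ z ≤ D`).
* `card_apIndex_coprime_le` — upper bound along a progression whose modulus has no prime factor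
  `< z`: `#{n ∈ apIndex N q r : (f(n), P(z)) = 1} ≤ (N/q) V(z) (F₂(log y/log z) + C (log y)^{−1/3})
  + y e⁸ log² z`.
* `card_coprime_dvd_eq_sum`, `card_coprime_dvd_le` — `S_p = #{n ≤ N : (f(n), P(z)) = 1, p ∣ f(n)}`
  splits over the `ω_f(p)` roots of `f` mod `p` into progressions mod `p`, whence (for a prime
  `p ≥ z`) `S_p ≤ ω_f(p) ((N/p) V(z) (F₂ + C (log y)^{−1/3}) + y e⁸ log² z)`.

Here `V(z) = ∏_{p<z} (1 − ω_f(p)/p)` and `P(z) = primesProdBelow z`.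

## References

* H. Iwaniec, *Rosser's sieve*, Acta Arith. 36 (1980), 171–202, Thm 1. [IwaniecActaArith1980]
* H. Diamond, H. Halberstam, LMS LN 237 (1997), 101–107, Thm 1. [DiamondHalberstam1997]
* H. Halberstam, H.-E. Richert, *Sieve Methods* (1974), Ch. 1 (Example 5), Thm 10.1. [HalberstamRichert1974]
-/

open Finset Real Polynomial

noncomputable section

namespace Literature.NumberTheory.Sieve

namespace PolySieveTwo

/-! ### Iwaniec's Theorem 1 at `κ = 2` for the canonical data -/

/-- **Iwaniec's Theorem 1, lower bound, `κ = 2`, canonical data**: for every `L` there is `C` such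
that for every sifted sequence `𝒜` with density of dimension `Ω(2, L)` and all `x`, `2 ≤ z ≤ y`,
`X ≥ 0`: `S(𝒜, z; x) ≥ X V(z) (f₂(log y/log z) − C (log y)^{−1/3}) − ∑_{d<y, d∣P(z)} |R_d(x)|`.
[cite: IwaniecActaArith1980, Thm 1 (1.5)] -/
theorem Iwaniec1980_two_lower :
    ∀ L : ℝ, ∃ C : ℝ, ∀ (A : SieveSequence), HasIwaniecDimension A.density 2 L →
      ∀ x y z : ℝ, 2 ≤ z → z ≤ y → 0 ≤ A.size x →
        A.size x * A.densityProduct (primesProdBelow z) *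
              (iwaniecLowerSieveFun 2 (Real.log y / Real.log z) - C * Real.log y ^ (-(1 / 3 : ℝ))) -
            ∑ d ∈ (Finset.range ⌈y⌉₊).filter (· ∣ primesProdBelow z), |A.remainder d x| ≤
          A.sifted x (primesProdBelow z) := by
  have hκ : (1 : ℝ) / 2 < 2 := by norm_num
  have hB := isGreatestBetaSieveData_greatestBetaSieveData' (κ := 2) hκ.le
  exact Iwaniec1980_thm1_lower_local (greatestBetaSieveData 2) hB
    (Iwaniec1980_mainTerm_lower_local hκ.le _ hB (BetaSieve.Iwaniec1980_lemma20_of_half_lt hκ _ hB))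

/-- **Iwaniec's Theorem 1, upper bound, `κ = 2`, canonical data**:
`S(𝒜, z; x) ≤ X V(z) (F₂(log y/log z) + C (log y)^{−1/3}) + ∑_{d<y, d∣P(z)} |R_d(x)|`.
[cite: IwaniecActaArith1980, Thm 1 (1.4)] -/
theorem Iwaniec1980_two_upper :
    ∀ L : ℝ, ∃ C : ℝ, ∀ (A : SieveSequence), HasIwaniecDimension A.density 2 L →
      ∀ x y z : ℝ, 2 ≤ z → z ≤ y → 0 ≤ A.size x →
        A.sifted x (primesProdBelow z) ≤
          A.size x * A.densityProduct (primesProdBelow z) *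
              (iwaniecUpperSieveFun 2 (Real.log y / Real.log z) + C * Real.log y ^ (-(1 / 3 : ℝ))) +
            ∑ d ∈ (Finset.range ⌈y⌉₊).filter (· ∣ primesProdBelow z), |A.remainder d x| := by
  have hκ : (1 : ℝ) / 2 < 2 := by norm_num
  have hB := isGreatestBetaSieveData_greatestBetaSieveData' (κ := 2) hκ.le
  exact Iwaniec1980_thm1_upper_local hκ.le (greatestBetaSieveData 2) hB
    (Iwaniec1980_mainTerm_upper_local hκ.le _ hB (BetaSieve.Iwaniec1980_lemma20_of_half_lt hκ _ hB))

/-! ### The remainder sum for polynomial sequences -/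

variable {f : ℤ[X]}

/-- The remainder sum of Theorem 1 for `polyAPSeq f N q r`: if no prime `< z` divides `q ≥ 1`,
`0 < f(n) ≤ x` on the index set, `ω_f(p) ≤ 2`, `z ≥ 2` and `y ≥ 0`, then
`∑_{d < y, d ∣ P(z)} |R_d(x)| ≤ y e⁸ log² z`. [cite: HalberstamRichert1974, Ch. 1 Example 5] -/
theorem sum_remainder_range_le (hle : ∀ p : ℕ, p.Prime → polyRootCountMod ![f] p ≤ 2)
    {N q r : ℕ} (hq : 0 < q) {x y z : ℝ} (hz : 2 ≤ z) (hy : 0 ≤ y)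
    (hqz : ∀ p : ℕ, p.Prime → (p : ℝ) < z → ¬ p ∣ q)
    (hx : ∀ n ∈ apIndex N q r, 0 < f.eval (n : ℤ) ∧ ((f.eval (n : ℤ) : ℤ) : ℝ) ≤ x) :
    ∑ d ∈ (Finset.range ⌈y⌉₊).filter (· ∣ primesProdBelow z), |(polyAPSeq f N q r).remainder d x| ≤
      y * (Real.exp 8 * Real.log z ^ 2) := by
  have hsub : (Finset.range ⌈y⌉₊).filter (· ∣ primesProdBelow z) ⊆
      (primesProdBelow z).divisors.filter (fun m : ℕ => (m : ℝ) ≤ y) := by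
    intro d hd
    rw [Finset.mem_filter, Finset.mem_range] at hd
    rw [Finset.mem_filter, Nat.mem_divisors]
    exact ⟨⟨hd.2, primesProdBelow_ne_zero z⟩, (Nat.lt_ceil.mp hd.1).le⟩
  calc ∑ d ∈ (Finset.range ⌈y⌉₊).filter (· ∣ primesProdBelow z), |(polyAPSeq f N q r).remainder d x|
      ≤ ∑ m ∈ (primesProdBelow z).divisors.filter (fun m : ℕ => (m : ℝ) ≤ y),
          |(polyAPSeq f N q r).remainder m x| :=
        Finset.sum_le_sum_of_subset_of_nonneg hsub fun _ _ _ => abs_nonneg _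
    _ ≤ ∑ m ∈ (primesProdBelow z).divisors.filter (fun m : ℕ => (m : ℝ) ≤ y),
          (polyRootCountMod ![f] m : ℝ) := sum_abs_remainder_polyAPSeq_le f hq hqz hx
    _ ≤ y * (Real.exp 8 * Real.log z ^ 2) := sum_rootCount_divisors_le hle hz hy

/-- `V(P(z))` of the polynomial sequence is the product `∏_{p<z} (1 − ω_f(p)/p)`, and it is positive
when `ω_f(2) ≤ 1`, `ω_f(p) ≤ 2`. [folklore] -/
theorem densityProduct_eq_and_pos (h2 : polyRootCountMod ![f] 2 ≤ 1)
    (hle : ∀ p : ℕ, p.Prime → polyRootCountMod ![f] p ≤ 2) (N q r : ℕ) (z : ℝ) :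
    (polyAPSeq f N q r).densityProduct (primesProdBelow z) =
        ∏ p ∈ Nat.primesBelow ⌈z⌉₊, (1 - (polyRootCountMod ![f] p : ℝ) / p) ∧
      0 < ∏ p ∈ Nat.primesBelow ⌈z⌉₊, (1 - (polyRootCountMod ![f] p : ℝ) / p) :=
  ⟨polyAPSeq_densityProduct f N q r z, prod_one_sub_rootCount_pos h2 hle z⟩

/-! ### The lower bound for the full sequence -/

/-- **Lower-bound sieve for `{f(n) : 1 ≤ n ≤ N}` (dimension `2`)**: if `ω_f(p) ≤ 2` and
`ω_f(m)/m` has Iwaniec dimension `Ω(2, L)`, there is `C` such that for all `N`, `x`, `2 ≤ z ≤ D` with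
`0 < f(n) ≤ x` on `(0, N]`:
`N V(z) (f₂(log D/log z) − C (log D)^{−1/3}) − D e⁸ log² z ≤ #{1 ≤ n ≤ N : (f(n), P(z)) = 1}`.
[cite: IwaniecActaArith1980, Thm 1 (1.5)] -/
theorem card_coprime_ge (hle : ∀ p : ℕ, p.Prime → polyRootCountMod ![f] p ≤ 2) {L : ℝ}
    (hdim : HasIwaniecDimension (rootDensity f) 2 L) :
    ∃ C : ℝ, ∀ (N : ℕ) (x z D : ℝ), 2 ≤ z → z ≤ D →
      (∀ n ∈ Ioc 0 N, 0 < f.eval (n : ℤ) ∧ ((f.eval (n : ℤ) : ℤ) : ℝ) ≤ x) →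
        (N : ℝ) * (∏ p ∈ Nat.primesBelow ⌈z⌉₊, (1 - (polyRootCountMod ![f] p : ℝ) / p)) *
              (iwaniecLowerSieveFun 2 (Real.log D / Real.log z) - C * Real.log D ^ (-(1 / 3 : ℝ))) -
            D * (Real.exp 8 * Real.log z ^ 2) ≤
          #((Ioc 0 N).filter fun n : ℕ => (f.eval (n : ℤ)).natAbs.Coprime (primesProdBelow z)) := by
  obtain ⟨C, hC⟩ := Iwaniec1980_two_lower L
  refine ⟨C, fun N x z D hz hzD hx => ?_⟩
  have hx' : ∀ n ∈ apIndex N 1 0, 0 < f.eval (n : ℤ) ∧ ((f.eval (n : ℤ) : ℤ) : ℝ) ≤ x := by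
    rw [apIndex_one]; exact hx
  have h := hC (polyAPSeq f N 1 0) (by rw [polyAPSeq_density]; exact hdim) x D z hz hzD
    (by rw [polyAPSeq_size]; positivity)
  rw [polyAPSeq_sifted f N 1 0 hx', apIndex_one, polyAPSeq_size, polyAPSeq_densityProduct, Nat.cast_one,
    div_one] at h
  have hR := sum_remainder_range_le hle (N := N) (r := 0) one_pos hz (by linarith)
    (fun p hp _ => hp.one_lt.ne' ∘ Nat.dvd_one.mp) hx' (y := D)
  linarith

/-! ### The upper bound along a progression -/

/-- **Upper-bound sieve for `{f(n) : n ≤ N, n ≡ r (mod q)}` (dimension `2`)**, for a modulus `q ≥ 1`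
without prime factors `< z`: there is `C = C(L)` such that for all `N, q, r`, `x`, `2 ≤ z ≤ y` with
`0 < f(n) ≤ x` on the progression:
`#{n ∈ apIndex N q r : (f(n), P(z)) = 1} ≤ (N/q) V(z) (F₂(log y/log z) + C (log y)^{−1/3}) + y e⁸ log² z`.
[cite: IwaniecActaArith1980, Thm 1 (1.4)] -/
theorem card_apIndex_coprime_le (hle : ∀ p : ℕ, p.Prime → polyRootCountMod ![f] p ≤ 2) {L : ℝ}
    (hdim : HasIwaniecDimension (rootDensity f) 2 L) :
    ∃ C : ℝ, ∀ (N q r : ℕ) (x z y : ℝ), 0 < q → (∀ p : ℕ, p.Prime → (p : ℝ) < z → ¬ p ∣ q) →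
      2 ≤ z → z ≤ y →
      (∀ n ∈ apIndex N q r, 0 < f.eval (n : ℤ) ∧ ((f.eval (n : ℤ) : ℤ) : ℝ) ≤ x) →
        (#((apIndex N q r).filter fun n : ℕ => (f.eval (n : ℤ)).natAbs.Coprime (primesProdBelow z)) : ℝ) ≤
          (N : ℝ) / q * (∏ p ∈ Nat.primesBelow ⌈z⌉₊, (1 - (polyRootCountMod ![f] p : ℝ) / p)) *
              (iwaniecUpperSieveFun 2 (Real.log y / Real.log z) + C * Real.log y ^ (-(1 / 3 : ℝ))) +
            y * (Real.exp 8 * Real.log z ^ 2) := by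
  obtain ⟨C, hC⟩ := Iwaniec1980_two_upper L
  refine ⟨C, fun N q r x z y hq hqz hz hzy hx => ?_⟩
  have h := hC (polyAPSeq f N q r) (by rw [polyAPSeq_density]; exact hdim) x y z hz hzy
    (by rw [polyAPSeq_size]; positivity)
  rw [polyAPSeq_sifted f N q r hx, polyAPSeq_size, polyAPSeq_densityProduct] at h
  have hR := sum_remainder_range_le hle (N := N) (r := r) hq hz (by linarith) hqz hx (y := y)
  linarith

/-! ### `S_p` through the roots of `f` modulo `p` -/

/-- **Splitting `S_p` over the roots mod `p`**: for `p ≥ 1`,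
`#{1 ≤ n ≤ N : (f(n), P) = 1, p ∣ f(n)} = ∑_{0 ≤ s < p, p ∣ f(s)} #{n ∈ apIndex N p s : (f(n), P) = 1}`.
[folklore] -/
theorem card_coprime_dvd_eq_sum (f : ℤ[X]) (N : ℕ) {p : ℕ} (hp : 0 < p) (P : ℕ) :
    #((Ioc 0 N).filter fun n : ℕ => (f.eval (n : ℤ)).natAbs.Coprime P ∧ (p : ℤ) ∣ f.eval (n : ℤ)) =
      ∑ s ∈ (range p).filter (fun s : ℕ => (p : ℤ) ∣ f.eval (s : ℤ)),
        #((apIndex N p s).filter fun n : ℕ => (f.eval (n : ℤ)).natAbs.Coprime P) := by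
  have h := card_filter_dvd_eval_eq_sum f ((Ioc 0 N).filter fun n : ℕ => (f.eval (n : ℤ)).natAbs.Coprime P) hp
  rw [Finset.filter_filter] at h
  rw [h]
  refine Finset.sum_congr rfl fun s _ => ?_
  congr 1
  unfold apIndex
  rw [Finset.filter_filter, Finset.filter_filter]
  exact Finset.filter_congr fun n _ => and_comm

/-- **The upper bound for `S_p`** (`p` prime, `p ≥ z ≥ 2`, `z ≤ y`, `0 < f(n) ≤ x` on `(0, N]`):
`S_p ≤ ω_f(p) ((N/p) V(z) (F₂(log y/log z) + C (log y)^{−1/3}) + y e⁸ log² z)`, with the constant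
`C` of `card_apIndex_coprime_le` (the progressions mod `p` have no prime factor `< z` in the modulus).
[cite: DiamondHalberstam1997, Thm 1 (proof via HR Thm 10.1)] -/
theorem card_coprime_dvd_le (h2 : polyRootCountMod ![f] 2 ≤ 1)
    (hle : ∀ p : ℕ, p.Prime → polyRootCountMod ![f] p ≤ 2) {L : ℝ}
    (hdim : HasIwaniecDimension (rootDensity f) 2 L) :
    ∃ C : ℝ, 0 ≤ C ∧ ∀ (N : ℕ) (x z y : ℝ) (p : ℕ), p.Prime → z ≤ (p : ℝ) → 2 ≤ z → z ≤ y →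
      (∀ n ∈ Ioc 0 N, 0 < f.eval (n : ℤ) ∧ ((f.eval (n : ℤ) : ℤ) : ℝ) ≤ x) →
        (#((Ioc 0 N).filter fun n : ℕ =>
            (f.eval (n : ℤ)).natAbs.Coprime (primesProdBelow z) ∧ (p : ℤ) ∣ f.eval (n : ℤ)) : ℝ) ≤
          (polyRootCountMod ![f] p : ℝ) *
            ((N : ℝ) / p * (∏ q ∈ Nat.primesBelow ⌈z⌉₊, (1 - (polyRootCountMod ![f] q : ℝ) / q)) *
                (iwaniecUpperSieveFun 2 (Real.log y / Real.log z) + C * Real.log y ^ (-(1 / 3 : ℝ))) +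
              y * (Real.exp 8 * Real.log z ^ 2)) := by
  obtain ⟨C, hC⟩ := card_apIndex_coprime_le hle hdim
  -- we may take `C ≥ 0`
  refine ⟨max C 0, le_max_right _ _, fun N x z y p hp hzp hz hzy hx => ?_⟩
  have hp0 : 0 < p := hp.pos
  have hqz : ∀ q : ℕ, q.Prime → (q : ℝ) < z → ¬ q ∣ p := by
    intro q hq hqz hqp
    have : q = p := (Nat.prime_dvd_prime_iff_eq hq hp).mp hqp
    subst this
    linarith
  rw [card_coprime_dvd_eq_sum f N hp0, Nat.cast_sum]
  have hV := prod_one_sub_rootCount_pos h2 hle z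
  set V := ∏ q ∈ Nat.primesBelow ⌈z⌉₊, (1 - (polyRootCountMod ![f] q : ℝ) / q) with hVdef
  set M := (N : ℝ) / p * V * (iwaniecUpperSieveFun 2 (Real.log y / Real.log z) +
      max C 0 * Real.log y ^ (-(1 / 3 : ℝ))) + y * (Real.exp 8 * Real.log z ^ 2) with hM
  have hterm : ∀ s ∈ (range p).filter (fun s : ℕ => (p : ℤ) ∣ f.eval (s : ℤ)),
      (#((apIndex N p s).filter fun n : ℕ => (f.eval (n : ℤ)).natAbs.Coprime (primesProdBelow z)) : ℝ) ≤ M := by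
    intro s _
    have hxs : ∀ n ∈ apIndex N p s, 0 < f.eval (n : ℤ) ∧ ((f.eval (n : ℤ) : ℤ) : ℝ) ≤ x :=
      fun n hn => hx n (apIndex_subset N p s hn)
    have h := hC N p s x z y hp0 hqz hz hzy hxs
    refine h.trans ?_
    rw [hM]
    have hly : 0 ≤ Real.log y ^ (-(1 / 3 : ℝ)) := Real.rpow_nonneg (Real.log_nonneg (by linarith)) _
    have hNV : 0 ≤ (N : ℝ) / p * V := by positivity
    have : C * Real.log y ^ (-(1 / 3 : ℝ)) ≤ max C 0 * Real.log y ^ (-(1 / 3 : ℝ)) :=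
      mul_le_mul_of_nonneg_right (le_max_left _ _) hly
    nlinarith
  calc ∑ s ∈ (range p).filter (fun s : ℕ => (p : ℤ) ∣ f.eval (s : ℤ)),
        (#((apIndex N p s).filter fun n : ℕ => (f.eval (n : ℤ)).natAbs.Coprime (primesProdBelow z)) : ℝ)
      ≤ ∑ _s ∈ (range p).filter (fun s : ℕ => (p : ℤ) ∣ f.eval (s : ℤ)), M := Finset.sum_le_sum hterm
    _ = (polyRootCountMod ![f] p : ℝ) * M := by
        rw [Finset.sum_const, nsmul_eq_mul, card_filter_dvd_eval_eq_polyRootCountMod]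

end PolySieveTwo

end Literature.NumberTheory.Sieve

end
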